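import Mathlib
import Literature.Analysis.FluidPDE.VectorCalculus

/-!
# Differentiability of the regularised Biot–Savart field of a proper filament

Tools stub `stub_biotSavartDifferentiable` of line `Sketch` (crux `SkeletonEquilibrium`, thesis
`FilamentSkeletonRss`). For the Rosenhead-regularised Biot–Savart law with core parameter `e ≠ 0`
and a `C¹` curve `X : ℝ → ℝ³` with `‖X′‖ ≤ 1` and linear growth `c |u| − C ≤ ‖X u‖` (`c > 0`),
the induced field
`y ↦ ∫ ((‖y − X u‖² + e²)^{3/2})⁻¹ • X′(u) × (y − X u) du`
is (Fréchet) differentiable on all of `ℝ³`.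

Proof: differentiation under the integral sign (Mathlib's
`hasFDerivAt_integral_of_dominated_of_fderiv_le`) at every point `y₀`, on the ball `B(y₀, 1)`.
With `v = y − X u`, `s = ‖v‖² + e² ≥ e² > 0`, the kernel `k(y) = s^{-3/2}` has derivative
`−3 s^{−5/2} ⟨v, ·⟩` (chain rule through `‖·‖²` and `rpow`), so the integrand
`F(y, u) = k • a × v` (`a = X′(u)`, `‖a‖ ≤ 1`) has `y`-derivative
`k • (a × ·) + (−3 s^{−5/2} ⟨v, ·⟩) ⊗ (a × v)` of operator norm `≤ s^{−3/2} + 3 s^{−5/2} ‖v‖²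
≤ 4 s^{−3/2} ≤ 4 |e|⁻¹ s⁻¹`, while `‖F(y, u)‖ ≤ s^{−3/2} ‖v‖ ≤ s⁻¹`. On the ball,
`‖v‖ ≥ c|u| − D` with `D = |C| + ‖y₀‖ + 1`, whence `1 + u² ≤ M s`,
`M = (4e² + c² + 4D²)/(c² e²)`, and both `F` and its derivative are dominated by constant
multiples of the integrable `(1 + u²)⁻¹` (`integrable_inv_one_add_sq`). Measurability of the
derivative `u ↦ ∂_y F(y₀, u)` is Mathlib's `measurable_fderiv_with_param` (the integrand is jointly
continuous in `(u, y)`).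
-/

noncomputable section

open MeasureTheory Filter Topology
open Literature.Analysis.FluidPDE

namespace Summit.NavierStokesRegularity.NavierStokesRegularity.Theorems.SkeletonEquilibrium.Sketch
set_option linter.dupNamespace false

/-- `‖a × b‖ ≤ ‖a‖ ‖b‖` (from `norm_cross`, `sin ≤ 1`). [folklore] -/
private theorem bsDiff_norm_cross_le (a b : EuclideanSpace ℝ (Fin 3)) :
    ‖cross a b‖ ≤ ‖a‖ * ‖b‖ := by
  rw [norm_cross]
  exact mul_le_of_le_one_right (by positivity) (Real.sin_le_one _)

/-- The operator `a × ·` has norm at most `‖a‖`. [folklore] -/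
private theorem bsDiff_norm_crossCLM_le (a : EuclideanSpace ℝ (Fin 3)) : ‖crossCLM a‖ ≤ ‖a‖ :=
  ContinuousLinearMap.opNorm_le_bound _ (norm_nonneg a) fun b => bsDiff_norm_cross_le a b

/-- The derivative of `y ↦ a × (y − b)` is `a × ·`. [folklore] -/
private theorem bsDiff_hasFDerivAt_cross_sub (a b y : EuclideanSpace ℝ (Fin 3)) :
    HasFDerivAt (fun y : EuclideanSpace ℝ (Fin 3) => cross a (y - b)) (crossCLM a) y := by
  have h := (crossCLM a).hasFDerivAt.comp y (hasFDerivAt_sub_const b)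
  simpa [Function.comp_def] using h

/-- The regularised kernel `y ↦ ((‖y − b‖² + e²)^{3/2})⁻¹` (`e ≠ 0`) has derivative
`−3 (‖y − b‖² + e²)^{−5/2} ⟨y − b, ·⟩`. [folklore] -/
private theorem bsDiff_hasFDerivAt_kernel {e : ℝ} (he : e ≠ 0) (b y : EuclideanSpace ℝ (Fin 3)) :
    HasFDerivAt (fun y : EuclideanSpace ℝ (Fin 3) => ((‖y - b‖ ^ 2 + e ^ 2) ^ (3 / 2 : ℝ))⁻¹)
      ((-3 * (‖y - b‖ ^ 2 + e ^ 2) ^ (-(5 / 2) : ℝ)) • innerSL ℝ (y - b)) y := by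
  have hpos : ∀ z : EuclideanSpace ℝ (Fin 3), 0 < ‖z - b‖ ^ 2 + e ^ 2 := fun z => by positivity
  have h1 : HasFDerivAt (fun y : EuclideanSpace ℝ (Fin 3) => ‖y - b‖ ^ 2 + e ^ 2)
      ((2 • innerSL ℝ (y - b)).comp (ContinuousLinearMap.id ℝ (EuclideanSpace ℝ (Fin 3)))) y :=
    ((hasStrictFDerivAt_norm_sq _).hasFDerivAt.comp y (hasFDerivAt_sub_const b)).add_const _
  have h2 := h1.rpow_const (p := -(3 / 2)) (Or.inl (hpos y).ne')
  have hfun : (fun y : EuclideanSpace ℝ (Fin 3) => ((‖y - b‖ ^ 2 + e ^ 2) ^ (3 / 2 : ℝ))⁻¹)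
      = fun y => (‖y - b‖ ^ 2 + e ^ 2) ^ (-(3 / 2) : ℝ) := by
    funext z
    rw [Real.rpow_neg (hpos z).le]
  rw [hfun]
  refine h2.congr_fderiv ?_
  rw [show (-(3 / 2) : ℝ) - 1 = -(5 / 2) by norm_num]
  ext h
  simp
  ring

/-- The `y`-derivative of the regularised Biot–Savart integrand `k_e(y − b) • a × (y − b)`
(product rule). [folklore] -/
private theorem bsDiff_hasFDerivAt_integrand {e : ℝ} (he : e ≠ 0)
    (a b y : EuclideanSpace ℝ (Fin 3)) :
    HasFDerivAt (fun y : EuclideanSpace ℝ (Fin 3) =>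
        ((‖y - b‖ ^ 2 + e ^ 2) ^ (3 / 2 : ℝ))⁻¹ • cross a (y - b))
      (((‖y - b‖ ^ 2 + e ^ 2) ^ (3 / 2 : ℝ))⁻¹ • crossCLM a +
        ((-3 * (‖y - b‖ ^ 2 + e ^ 2) ^ (-(5 / 2) : ℝ)) • innerSL ℝ (y - b)).smulRight
          (cross a (y - b))) y :=
  (bsDiff_hasFDerivAt_kernel he b y).smul (bsDiff_hasFDerivAt_cross_sub a b y)

/-- Scalar kernel estimate: `s^{−3/2} ≤ |e|⁻¹ s⁻¹` for `s ≥ e² > 0`. [folklore] -/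
private theorem bsDiff_rpow_neg_three_halves_le {e s : ℝ} (he : e ≠ 0) (hs : e ^ 2 ≤ s) :
    s ^ (-(3 / 2) : ℝ) ≤ |e|⁻¹ * s⁻¹ := by
  have he2 : 0 < e ^ 2 := by positivity
  have hs0 : 0 < s := he2.trans_le hs
  rw [show (-(3 / 2) : ℝ) = -(1 / 2) + -1 by norm_num, Real.rpow_add hs0, Real.rpow_neg_one]
  refine mul_le_mul_of_nonneg_right ?_ (inv_nonneg.2 hs0.le)
  calc s ^ (-(1 / 2) : ℝ) ≤ (e ^ 2) ^ (-(1 / 2) : ℝ) :=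
        Real.rpow_le_rpow_of_nonpos he2 hs (by norm_num)
    _ = |e|⁻¹ := by
        rw [Real.rpow_neg he2.le, ← Real.sqrt_eq_rpow, Real.sqrt_sq_eq_abs]

/-- Pointwise bound on the integrand: `‖k_e(v) • a × v‖ ≤ (‖v‖² + e²)⁻¹` for `‖a‖ ≤ 1`
(as `‖v‖ ≤ (‖v‖² + e²)^{1/2}`). [folklore] -/
private theorem bsDiff_norm_integrand_le {e : ℝ} (he : e ≠ 0) (a v : EuclideanSpace ℝ (Fin 3))
    (ha : ‖a‖ ≤ 1) :
    ‖((‖v‖ ^ 2 + e ^ 2) ^ (3 / 2 : ℝ))⁻¹ • cross a v‖ ≤ (‖v‖ ^ 2 + e ^ 2)⁻¹ := by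
  have hs0 : 0 < ‖v‖ ^ 2 + e ^ 2 := by positivity
  have hv : ‖v‖ ≤ (‖v‖ ^ 2 + e ^ 2) ^ (1 / 2 : ℝ) := by
    rw [← Real.sqrt_eq_rpow]
    exact Real.le_sqrt_of_sq_le (by nlinarith [sq_nonneg e])
  rw [norm_smul, norm_inv, Real.norm_of_nonneg (Real.rpow_nonneg hs0.le _),
    ← Real.rpow_neg hs0.le]
  calc (‖v‖ ^ 2 + e ^ 2) ^ (-(3 / 2) : ℝ) * ‖cross a v‖
      ≤ (‖v‖ ^ 2 + e ^ 2) ^ (-(3 / 2) : ℝ) * (‖v‖ ^ 2 + e ^ 2) ^ (1 / 2 : ℝ) := by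
        refine mul_le_mul_of_nonneg_left ?_ (Real.rpow_nonneg hs0.le _)
        calc ‖cross a v‖ ≤ ‖a‖ * ‖v‖ := bsDiff_norm_cross_le a v
          _ ≤ 1 * ‖v‖ := mul_le_mul_of_nonneg_right ha (norm_nonneg _)
          _ ≤ _ := by rw [one_mul]; exact hv
    _ = (‖v‖ ^ 2 + e ^ 2)⁻¹ := by
        rw [← Real.rpow_add hs0, show (-(3 / 2) : ℝ) + 1 / 2 = -1 by norm_num, Real.rpow_neg_one]

/-- Operator-norm bound on the `y`-derivative of the integrand:
`‖k • (a × ·) + (−3 s^{−5/2} ⟨v, ·⟩) ⊗ (a × v)‖ ≤ 4 |e|⁻¹ (‖v‖² + e²)⁻¹` for `‖a‖ ≤ 1`.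
[folklore] -/
private theorem bsDiff_norm_fderiv_integrand_le {e : ℝ} (he : e ≠ 0)
    (a v : EuclideanSpace ℝ (Fin 3)) (ha : ‖a‖ ≤ 1) :
    ‖((‖v‖ ^ 2 + e ^ 2) ^ (3 / 2 : ℝ))⁻¹ • crossCLM a +
        ((-3 * (‖v‖ ^ 2 + e ^ 2) ^ (-(5 / 2) : ℝ)) • innerSL ℝ v).smulRight (cross a v)‖
      ≤ 4 * |e|⁻¹ * (‖v‖ ^ 2 + e ^ 2)⁻¹ := by
  set s := ‖v‖ ^ 2 + e ^ 2 with hs_def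
  have hs0 : 0 < s := by positivity
  have hes : e ^ 2 ≤ s := le_add_of_nonneg_left (sq_nonneg _)
  have hvs : ‖v‖ ^ 2 ≤ s := le_add_of_nonneg_right (sq_nonneg e)
  have hk : (s ^ (3 / 2 : ℝ))⁻¹ = s ^ (-(3 / 2) : ℝ) := (Real.rpow_neg hs0.le _).symm
  have h1 : ‖(s ^ (3 / 2 : ℝ))⁻¹ • crossCLM a‖ ≤ s ^ (-(3 / 2) : ℝ) := by
    rw [norm_smul, hk, Real.norm_of_nonneg (Real.rpow_nonneg hs0.le _)]
    calc s ^ (-(3 / 2) : ℝ) * ‖crossCLM a‖ ≤ s ^ (-(3 / 2) : ℝ) * 1 :=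
          mul_le_mul_of_nonneg_left ((bsDiff_norm_crossCLM_le a).trans ha)
            (Real.rpow_nonneg hs0.le _)
      _ = _ := mul_one _
  have h2 : ‖((-3 * s ^ (-(5 / 2) : ℝ)) • innerSL ℝ v).smulRight (cross a v)‖
      ≤ 3 * s ^ (-(3 / 2) : ℝ) := by
    rw [ContinuousLinearMap.norm_smulRight_apply, norm_smul, innerSL_apply_norm, Real.norm_eq_abs,
      abs_mul, abs_neg, abs_of_pos (by norm_num : (0 : ℝ) < 3),
      abs_of_nonneg (Real.rpow_nonneg hs0.le _)]
    calc 3 * s ^ (-(5 / 2) : ℝ) * ‖v‖ * ‖cross a v‖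
        ≤ 3 * s ^ (-(5 / 2) : ℝ) * ‖v‖ * (1 * ‖v‖) := by
          refine mul_le_mul_of_nonneg_left ?_ (by positivity)
          exact (bsDiff_norm_cross_le a v).trans (mul_le_mul_of_nonneg_right ha (norm_nonneg _))
      _ = 3 * (s ^ (-(5 / 2) : ℝ) * ‖v‖ ^ 2) := by ring
      _ ≤ 3 * (s ^ (-(5 / 2) : ℝ) * s) := by gcongr
      _ = 3 * s ^ (-(3 / 2) : ℝ) := by
          rw [show (-(3 / 2) : ℝ) = -(5 / 2) + 1 by norm_num, Real.rpow_add_one hs0.ne']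
  calc _ ≤ _ := norm_add_le _ _
    _ ≤ s ^ (-(3 / 2) : ℝ) + 3 * s ^ (-(3 / 2) : ℝ) := add_le_add h1 h2
    _ = 4 * s ^ (-(3 / 2) : ℝ) := by ring
    _ ≤ 4 * (|e|⁻¹ * s⁻¹) := by
        have := bsDiff_rpow_neg_three_halves_le he hes
        linarith
    _ = 4 * |e|⁻¹ * s⁻¹ := (mul_assoc _ _ _).symm

/-- Far-field growth: if `c t − D ≤ r` (`c, D > 0`, `r, t ≥ 0`, `e ≠ 0`) then
`1 + t² ≤ M (r² + e²)` with `M = (4e² + c² + 4D²)/(c² e²)` (from `c² t² ≤ 4 r² + 4 D²`).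
[folklore] -/
private theorem bsDiff_one_add_sq_le {c D r t e : ℝ} (hc : 0 < c) (hD : 0 < D) (hr : 0 ≤ r)
    (ht : 0 ≤ t) (he : e ≠ 0) (h : c * t - D ≤ r) :
    1 + t ^ 2 ≤ (4 * e ^ 2 + c ^ 2 + 4 * D ^ 2) / (c ^ 2 * e ^ 2) * (r ^ 2 + e ^ 2) := by
  have key : c ^ 2 * t ^ 2 ≤ 4 * r ^ 2 + 4 * D ^ 2 := by
    rcases le_or_gt (c * t) D with h1 | h1
    · have hct : 0 ≤ c * t := mul_nonneg hc.le ht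
      nlinarith [mul_le_mul h1 h1 hct hD.le, sq_nonneg r]
    · have hctD : 0 ≤ c * t - D := by linarith
      nlinarith [mul_le_mul h h hctD hr, sq_nonneg (3 * c * t - 4 * D), sq_nonneg D]
  have he2 : 0 < e ^ 2 := by positivity
  have hc2 : 0 < c ^ 2 := by positivity
  rw [div_mul_eq_mul_div, le_div_iff₀ (by positivity)]
  nlinarith [mul_le_mul_of_nonneg_left key he2.le, mul_nonneg (sq_nonneg r) he2.le,
    mul_nonneg hc2.le (sq_nonneg r), mul_nonneg (sq_nonneg D) (sq_nonneg r), sq_nonneg (e ^ 2)]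

/-- Uniform domination on the unit ball around `y₀`: for `y ∈ B(y₀, 1)`,
`(‖y − X u‖² + e²)⁻¹ ≤ M (1 + u²)⁻¹` with `M = (4e² + c² + 4D²)/(c² e²)`,
`D = |C| + ‖y₀‖ + 1`. [folklore] -/
private theorem bsDiff_inv_le_of_mem_ball {e c C : ℝ} {X : ℝ → EuclideanSpace ℝ (Fin 3)}
    (he : e ≠ 0) (hc : 0 < c) (hXg : ∀ u, c * |u| - C ≤ ‖X u‖) (y₀ : EuclideanSpace ℝ (Fin 3))
    {y : EuclideanSpace ℝ (Fin 3)} (hy : y ∈ Metric.ball y₀ 1) (u : ℝ) :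
    (‖y - X u‖ ^ 2 + e ^ 2)⁻¹ ≤
      (4 * e ^ 2 + c ^ 2 + 4 * (|C| + ‖y₀‖ + 1) ^ 2) / (c ^ 2 * e ^ 2) * (1 + u ^ 2)⁻¹ := by
  have hD : 0 < |C| + ‖y₀‖ + 1 := by positivity
  have hy' : ‖y - y₀‖ < 1 := mem_ball_iff_norm.1 hy
  have hr : c * |u| - (|C| + ‖y₀‖ + 1) ≤ ‖y - X u‖ := by
    have h1 := norm_sub_norm_le (X u) y
    have h2 := norm_le_norm_add_norm_sub' y y₀
    have h3 := hXg u
    have h4 := le_abs_self C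
    rw [norm_sub_rev] at h1
    linarith
  have key := bsDiff_one_add_sq_le hc hD (norm_nonneg _) (abs_nonneg u) he hr
  rw [sq_abs] at key
  have hs0 : 0 < ‖y - X u‖ ^ 2 + e ^ 2 := by positivity
  have h1u : 0 < 1 + u ^ 2 := by positivity
  rw [← div_eq_mul_inv, le_div_iff₀ h1u, inv_mul_le_iff₀ hs0]
  linarith [mul_comm ((4 * e ^ 2 + c ^ 2 + 4 * (|C| + ‖y₀‖ + 1) ^ 2) / (c ^ 2 * e ^ 2))
    (‖y - X u‖ ^ 2 + e ^ 2)]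

/-- Joint continuity of the integrand in `(u, y)`. [folklore] -/
private theorem bsDiff_continuous_integrand {e : ℝ} (he : e ≠ 0)
    {X : ℝ → EuclideanSpace ℝ (Fin 3)} (hX : ContDiff ℝ 1 X) :
    Continuous (fun p : ℝ × EuclideanSpace ℝ (Fin 3) =>
      ((‖p.2 - X p.1‖ ^ 2 + e ^ 2) ^ (3 / 2 : ℝ))⁻¹ • cross (deriv X p.1) (p.2 - X p.1)) := by
  have hXc : Continuous X := hX.continuous
  have hX'c : Continuous (deriv X) := hX.continuous_deriv le_rfl
  have hv : Continuous (fun p : ℝ × EuclideanSpace ℝ (Fin 3) => p.2 - X p.1) :=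
    continuous_snd.sub (hXc.comp continuous_fst)
  have hcr : Continuous (fun p : ℝ × EuclideanSpace ℝ (Fin 3) =>
      cross (deriv X p.1) (p.2 - X p.1)) :=
    (crossCLM.continuous.comp (hX'c.comp continuous_fst)).clm_apply hv
  have hk : Continuous (fun p : ℝ × EuclideanSpace ℝ (Fin 3) =>
      ((‖p.2 - X p.1‖ ^ 2 + e ^ 2) ^ (3 / 2 : ℝ))⁻¹) := by
    refine (((hv.norm.pow 2).add continuous_const).rpow_const fun p => Or.inr (by norm_num)).inv₀
      fun p => ?_
    have : 0 < ‖p.2 - X p.1‖ ^ 2 + e ^ 2 := by positivity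
    exact (Real.rpow_pos_of_pos this _).ne'
  exact hk.smul hcr

/-- Differentiation under the integral sign at a point `y₀`: the regularised Biot–Savart field has
Fréchet derivative `∫ ∂_y F(y₀, u) du` at `y₀`. [folklore] -/
private theorem bsDiff_hasFDerivAt_field {e c C : ℝ} {X : ℝ → EuclideanSpace ℝ (Fin 3)}
    (he : e ≠ 0) (hc : 0 < c) (hX : ContDiff ℝ 1 X) (hX1 : ∀ u, ‖deriv X u‖ ≤ 1)
    (hXg : ∀ u, c * |u| - C ≤ ‖X u‖) (y₀ : EuclideanSpace ℝ (Fin 3)) :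
    HasFDerivAt (fun y : EuclideanSpace ℝ (Fin 3) => ∫ u : ℝ,
        ((‖y - X u‖ ^ 2 + e ^ 2) ^ (3 / 2 : ℝ))⁻¹ • cross (deriv X u) (y - X u))
      (∫ u : ℝ, fderiv ℝ (fun y : EuclideanSpace ℝ (Fin 3) =>
        ((‖y - X u‖ ^ 2 + e ^ 2) ^ (3 / 2 : ℝ))⁻¹ • cross (deriv X u) (y - X u)) y₀) y₀ := by
  set M : ℝ := (4 * e ^ 2 + c ^ 2 + 4 * (|C| + ‖y₀‖ + 1) ^ 2) / (c ^ 2 * e ^ 2) with hM_def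
  have hcont := bsDiff_continuous_integrand he hX
  have hFy : ∀ y : EuclideanSpace ℝ (Fin 3), Continuous (fun u : ℝ =>
      ((‖y - X u‖ ^ 2 + e ^ 2) ^ (3 / 2 : ℝ))⁻¹ • cross (deriv X u) (y - X u)) :=
    fun y => hcont.curry_left (y := y)
  have hdom : ∀ u : ℝ, ∀ y ∈ Metric.ball y₀ 1,
      (‖y - X u‖ ^ 2 + e ^ 2)⁻¹ ≤ M * (1 + u ^ 2)⁻¹ :=
    fun u y hy => bsDiff_inv_le_of_mem_ball he hc hXg y₀ hy u
  refine hasFDerivAt_integral_of_dominated_of_fderiv_le (𝕜 := ℝ) (μ := volume) (x₀ := y₀)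
    (F := fun (y : EuclideanSpace ℝ (Fin 3)) (u : ℝ) =>
      ((‖y - X u‖ ^ 2 + e ^ 2) ^ (3 / 2 : ℝ))⁻¹ • cross (deriv X u) (y - X u))
    (F' := fun (y : EuclideanSpace ℝ (Fin 3)) (u : ℝ) =>
      fderiv ℝ (fun y : EuclideanSpace ℝ (Fin 3) =>
        ((‖y - X u‖ ^ 2 + e ^ 2) ^ (3 / 2 : ℝ))⁻¹ • cross (deriv X u) (y - X u)) y)
    (bound := fun u => 4 * |e|⁻¹ * (M * (1 + u ^ 2)⁻¹))
    (Metric.ball_mem_nhds y₀ one_pos) ?_ ?_ ?_ ?_ ?_ ?_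
  · exact Eventually.of_forall fun y => (hFy y).aestronglyMeasurable
  · refine (integrable_inv_one_add_sq.const_mul M).mono' (hFy y₀).aestronglyMeasurable
      (Eventually.of_forall fun u => ?_)
    exact (bsDiff_norm_integrand_le he _ _ (hX1 u)).trans
      (hdom u y₀ (Metric.mem_ball_self one_pos))
  · have hm := measurable_fderiv_with_param ℝ
      (f := fun (u : ℝ) (y : EuclideanSpace ℝ (Fin 3)) =>
        ((‖y - X u‖ ^ 2 + e ^ 2) ^ (3 / 2 : ℝ))⁻¹ • cross (deriv X u) (y - X u)) hcont
    exact (hm.comp measurable_prodMk_right).aestronglyMeasurable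
  · refine Eventually.of_forall fun u y hy => ?_
    rw [(bsDiff_hasFDerivAt_integrand he (deriv X u) (X u) y).fderiv]
    calc _ ≤ 4 * |e|⁻¹ * (‖y - X u‖ ^ 2 + e ^ 2)⁻¹ :=
          bsDiff_norm_fderiv_integrand_le he _ _ (hX1 u)
      _ ≤ 4 * |e|⁻¹ * (M * (1 + u ^ 2)⁻¹) :=
          mul_le_mul_of_nonneg_left (hdom u y hy) (by positivity)
  · exact (integrable_inv_one_add_sq.const_mul M).const_mul _
  · exact Eventually.of_forall fun u y _ =>
      (bsDiff_hasFDerivAt_integrand he (deriv X u) (X u) y).differentiableAt.hasFDerivAt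

/-- **Tools stub** (`stub_biotSavartDifferentiable`): for `e ≠ 0`, `c > 0` and a `C¹` curve
`X : ℝ → ℝ³` with `‖X′‖ ≤ 1` and linear growth `c |u| − C ≤ ‖X u‖`, the Rosenhead-regularised
Biot–Savart field `y ↦ ∫ ((‖y − X u‖² + e²)^{3/2})⁻¹ • X′(u) × (y − X u) du` is differentiable
on `ℝ³` (differentiation under the integral sign, dominated on unit balls by a multiple of
`(1 + u²)⁻¹`). [folklore] -/
theorem stub_biotSavartDifferentiable : ∀ (e c C : ℝ) (X : ℝ → EuclideanSpace ℝ (Fin 3)), e ≠ 0 → 0 < c → ContDiff ℝ 1 X → (∀ u, ‖deriv X u‖ ≤ 1) → (∀ u, c * |u| - C ≤ ‖X u‖) → Differentiable ℝ (fun y : EuclideanSpace ℝ (Fin 3) => ∫ u : ℝ, ((‖y - X u‖ ^ 2 + e ^ 2) ^ (3 / 2 : ℝ))⁻¹ • Literature.Analysis.FluidPDE.cross (deriv X u) (y - X u)) := by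
  intro e c C X he hc hX hX1 hXg y₀
  exact (bsDiff_hasFDerivAt_field he hc hX hX1 hXg y₀).differentiableAt

end Summit.NavierStokesRegularity.NavierStokesRegularity.Theorems.SkeletonEquilibrium.Sketch
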